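import Mathlib.FieldTheory.Finite.Basic
import Mathlib.Algebra.CharP.Lemmas
import Mathlib.Algebra.CharP.Frobenius
import Mathlib.Logic.Equiv.Prod
import Literature.Computability.AlgebraicComplexity.CohnUmansSU2TPP
import HarnessLib

/-!
# Cohn–Umans 2003, Prop. 5.2 (arXiv Prop. 11), the count `|SU₂(𝔽_q)| = q³ − q`: `SL₂(𝔽_{q²})`
# realizes `⟨q², q², q³ − q⟩` literally

Topic `Literature/Computability/AlgebraicComplexity` (group-theoretic matrix multiplication), namespace
`Literature.Computability.AlgebraicComplexity`; sequel to `CohnUmansSU2TPP.lean` (`su2`, `CohnUmans2003_prop11 :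
RealizesTPP (SL(2, R)) |R| |R| (Nat.card (su2 R))`), which left the third size as `Nat.card (su2 R)` with the
remark "NOT formalised: the count `|SU₂(𝔽_q)| = q³ − q`". This file supplies that count and the literal
statement of the proposition.

H. Cohn, C. Umans, *A group-theoretic approach to fast matrix multiplication*, FOCS 2003 = arXiv:math/0307321, §5
"Linear groups", Proposition 11 of the arXiv text (statement p. 7, proof pp. 7–8; = Prop. 5.2 of the FOCS
version), verbatim (held text `paper:arxiv-math_0307321`, p0007 L162–L191, p0008 L1–L22):

> "**Proposition 11.** The group `SL₂(𝔽_{q²})` of order `q⁶ − q²` realizes `⟨q², q², q³ − q⟩`.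
> *Proof.* Let `x ↦ x̄` denote the Frobenius automorphism of `𝔽_{q²}` over `𝔽_q`. The three subgroups we will use
> are `H₁ = {(1 x; 0 1) : x ∈ 𝔽_{q²}}`, `H₂ = {(1 0; y 1) : y ∈ 𝔽_{q²}}`, and
> `H₃ = SU₂(𝔽_q) = {(a b; −b̄ ā) : a, b ∈ 𝔽_{q²}, a ā + b b̄ = 1}`.
> Note that to check that `|H₃| = q³ − q`, one just needs to count solutions to `a ā + b b̄ = 1`. For a fixed `b`
> with `b b̄ ≠ 1`, there are `q + 1` corresponding choices of `a` that work; if `b b̄ = 1`, then `a = 0`. There are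
> `(q² − 1) − (q + 1)` non-zero choices of `b` with `b b̄ ≠ 1` (to which we must add `b = 0`), and `q + 1` with
> `b b̄ = 1`. Thus, there are `(q² − q − 1)(q + 1) + (q + 1) = q³ − q` elements of `H₃`.
> As in the previous proof, checking the triple product property amounts to checking that
> `(1+xy x; y 1) = (a b; −b̄ ā)` implies `x = y = b = 0` and `a = 1`, which is a trivial calculation. □"

## Lean rendering (this file; all statements are the printed ones, no named facts)

* `natCard_su2` — "`|H₃|` = number of solutions of `a ā + b b̄ = 1`": `su2 R ≃ {(a, b) : a ā + b b̄ = 1}` via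
  `M ↦ (M₀₀, M₀₁)` (the determinant of `(a b; −b̄ ā)` is `a ā + b b̄`), over any commutative ring with a star.
* `card_normPairs_eq` — **the printed count**, for a finite field `L` with `|L| = q²` and a star with `x̄ = x^q`
  (the Frobenius over `𝔽_q`): `#{(a, b) : a ā + b b̄ = 1} = q³ − q`, proved exactly as printed: the fibres of the
  norm `x ↦ x x̄ = x^{q+1}` over the non-zero elements fixed by `¯` have `q + 1` points each
  (`card_fibre_norm_eq`: at most `q + 1` as roots of `X^{q+1} − k`, at most `q − 1` non-zero fixed points as roots
  of `X^{q−1} − 1`, and the `q² − 1` non-zero `x` are distributed among these fibres, forcing equality), the fibre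
  over `0` is `{0}`; then summing over the first coordinate (the paper fixes `b`; the equation is symmetric) gives
  `(q + 1)·1 + (q² − (q + 1))·(q + 1) = q³ − q`.
* `star_eq_pow_of_card_eq_sq` — the phrase "`x ↦ x̄` denote[s] the Frobenius automorphism of `𝔽_{q²}` over
  `𝔽_q`" for an ABSTRACT star: any non-identity star (involutive ring automorphism) on a field with `q²` elements
  is `x ↦ x^q` (Mathlib: every `K`-algebra endomorphism of a finite field is a power of the `|K|`-Frobenius,
  `FiniteField.bijective_frobeniusAlgHom_pow`, applied over the fixed field `K` of the star).
* `CohnUmans2003_prop11_natCard_su2 : Nat.card (su2 L) = q ^ 3 - q` and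
  **`CohnUmans2003_prop11_sizes : RealizesTPP (SL(2, L)) (q ^ 2) (q ^ 2) (q ^ 3 - q)`** for such a star
  (or any non-identity star, `…_of_ne`), and the literal, star-free form
  **`CohnUmans2003_prop11_literal (hL : Fintype.card L = q ^ 2) : RealizesTPP (SL(2, L)) (q ^ 2) (q ^ 2) (q ^ 3 - q)`**
  (the star is built from the `q`-Frobenius `iterateFrobenius`, an involution because `x^{q²} = x`).

The order `|SL₂(𝔽_{q²})| = q⁶ − q²` is not restated (Mathlib `Matrix.SpecialLinearGroup` has the group; the order
plays no role in the realization statement, cf. `CohnUmansSL2TPP.lean`).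

## References
* H. Cohn, C. Umans, FOCS 2003, 438–449; arXiv:math/0307321, §5, Prop. 11 of the arXiv text (pp. 7–8)
  (= Prop. 5.2 of the FOCS version). [CohnUmans2003]
-/

namespace Literature.Computability.AlgebraicComplexity

open Finset Matrix Polynomial Literature.Combinatorics.Additive

/-! ## `|H₃|` is the number of solutions of `a ā + b b̄ = 1` -/

section Pairs

variable (R : Type*) [CommRing R] [StarRing R]

/-- "to check that `|H₃| = q³ − q`, one just needs to count solutions to `a ā + b b̄ = 1`": the map
`(a b; −b̄ ā) ↦ (a, b)` is a bijection from `su2 R` onto `{(a, b) : a ā + b b̄ = 1}` (the determinant condition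
is `a ā + b b̄ = 1`). [cite: CohnUmans2003, Prop. 11 (arXiv, p. 8 L1–2; proof)] -/
theorem natCard_su2 :
    Nat.card (su2 R) = Nat.card {p : R × R // p.1 * star p.1 + p.2 * star p.2 = 1} := by
  have hdet : ∀ a b : R, Matrix.det !![a, b; -star b, star a] = a * star a + b * star b := fun a b => by
    rw [Matrix.det_fin_two_of]; ring
  have key : ∀ M : su2 R,
      ((M : SpecialLinearGroup (Fin 2) R) : Matrix (Fin 2) (Fin 2) R) 0 0 *
          star (((M : SpecialLinearGroup (Fin 2) R) : Matrix (Fin 2) (Fin 2) R) 0 0) +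
        ((M : SpecialLinearGroup (Fin 2) R) : Matrix (Fin 2) (Fin 2) R) 0 1 *
          star (((M : SpecialLinearGroup (Fin 2) R) : Matrix (Fin 2) (Fin 2) R) 0 1) = 1 := fun M => by
    obtain ⟨h1, h2⟩ := mem_su2.1 M.2
    have hd := (M : SpecialLinearGroup (Fin 2) R).det_coe
    rw [Matrix.det_fin_two, h1, h2] at hd
    linear_combination hd
  let f : su2 R → {p : R × R // p.1 * star p.1 + p.2 * star p.2 = 1} := fun M =>
    ⟨(((M : SpecialLinearGroup (Fin 2) R) : Matrix (Fin 2) (Fin 2) R) 0 0,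
      ((M : SpecialLinearGroup (Fin 2) R) : Matrix (Fin 2) (Fin 2) R) 0 1), key M⟩
  let g : {p : R × R // p.1 * star p.1 + p.2 * star p.2 = 1} → su2 R := fun p =>
    ⟨⟨!![p.1.1, p.1.2; -star p.1.2, star p.1.1], by rw [hdet]; exact p.2⟩, by
      rw [mem_su2]; constructor <;> simp⟩
  refine Nat.card_congr
    { toFun := f
      invFun := g
      left_inv := fun M => ?_
      right_inv := fun p => ?_ }
  · obtain ⟨h1, h2⟩ := mem_su2.1 M.2
    apply Subtype.ext
    apply Subtype.ext
    ext i j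
    fin_cases i <;> fin_cases j <;> simp [f, g, h1, h2]
  · obtain ⟨⟨a, b⟩, h⟩ := p
    simp [f, g]

end Pairs

/-! ## The printed count over `𝔽_{q²}` -/

section Count

variable {L : Type*} [Field L] [DecidableEq L]

/-- Root count: `X^n − a` has at most `n` roots. [folklore] -/
private theorem card_nthRootsFinset_le' (n : ℕ) (a : L) : #(nthRootsFinset n a) ≤ n := by
  rw [nthRootsFinset_def]
  exact (Multiset.toFinset_card_le _).trans (card_nthRoots n a)

/-- Double counting: if `f` maps `s` into `t`, every fibre over `t` has at most `c` points and `|t|·c ≤ |s|`,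
then every fibre over `t` has exactly `c` points. [folklore] -/
private theorem card_fibre_eq_of_le {α β : Type*} [DecidableEq β] (s : Finset α) (t : Finset β) (f : α → β)
    (c : ℕ) (hmaps : ∀ a ∈ s, f a ∈ t) (hle : ∀ b ∈ t, #{a ∈ s | f a = b} ≤ c) (hcard : #t * c ≤ #s) :
    ∀ b ∈ t, #{a ∈ s | f a = b} = c := by
  by_contra hcon
  push Not at hcon
  obtain ⟨b₀, hb₀, hne⟩ := hcon
  have hsum : #s = ∑ b ∈ t, #{a ∈ s | f a = b} := card_eq_sum_card_fiberwise fun a ha => hmaps a ha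
  have hlt : ∑ b ∈ t, #{a ∈ s | f a = b} < ∑ b ∈ t, c :=
    sum_lt_sum hle ⟨b₀, hb₀, lt_of_le_of_ne (hle b₀ hb₀) hne⟩
  rw [sum_const, smul_eq_mul, ← hsum] at hlt
  exact lt_irrefl _ (hcard.trans_lt hlt)

variable [StarRing L] {q : ℕ}

/-- With `x̄ = x^q`: the fibre `{x : x x̄ = k}` lies in the roots of `X^{q+1} − k`, so has at most `q + 1`
points. [cite: CohnUmans2003, Prop. 11 (arXiv, p. 8 L2–3: "there are `q+1` corresponding choices")] -/
private theorem card_fibre_norm_le (hstar : ∀ x : L, star x = x ^ q) (s : Finset L) (k : L) :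
    #{x ∈ s | x * star x = k} ≤ q + 1 :=
  calc #{x ∈ s | x * star x = k} ≤ #(nthRootsFinset (q + 1) k) := card_le_card fun x hx => by
          rw [mem_filter] at hx
          rw [mem_nthRootsFinset (Nat.succ_pos q), pow_succ', ← hstar x]
          exact hx.2
    _ ≤ q + 1 := card_nthRootsFinset_le' _ _

variable [Fintype L]

/-- With `x̄ = x^q`, `q ≥ 2`: the non-zero elements fixed by `¯` (`= 𝔽_q^×`) are roots of `X^{q−1} − 1`, so
there are at most `q − 1` of them. [folklore] -/
private theorem card_fixed_ne_zero_le (hstar : ∀ x : L, star x = x ^ q) (hq : 2 ≤ q) :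
    #(univ.filter fun k : L => k ≠ 0 ∧ star k = k) ≤ q - 1 :=
  calc #(univ.filter fun k : L => k ≠ 0 ∧ star k = k) ≤ #(nthRootsFinset (q - 1) (1 : L)) :=
        card_le_card fun k hk => by
          rw [mem_filter] at hk
          obtain ⟨-, hk0, hk1⟩ := hk
          rw [mem_nthRootsFinset (by omega : 0 < q - 1)]
          rw [hstar] at hk1
          have : k ^ (q - 1) * k = 1 * k := by
            rw [← pow_succ, one_mul, Nat.sub_add_cancel (by omega : 1 ≤ q), hk1]
          exact mul_right_cancel₀ hk0 this
    _ ≤ q - 1 := card_nthRootsFinset_le' _ _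

/-- **Fibres of the norm** (`|L| = q²`, `x̄ = x^q`): for every non-zero `k` with `k̄ = k` (i.e. `k ∈ 𝔽_q^×`),
exactly `q + 1` elements `x` satisfy `x x̄ = k` — the `q² − 1` non-zero `x` fall into at most `q − 1` such
fibres of at most `q + 1` points each, and `(q − 1)(q + 1) = q² − 1`.
[cite: CohnUmans2003, Prop. 11 (arXiv, p. 8 L2–3: "For a fixed `b` with `b b̄ ≠ 1`, there are `q+1`
corresponding choices of `a` that work")] -/
theorem card_fibre_norm_eq (hL : Fintype.card L = q ^ 2) (hstar : ∀ x : L, star x = x ^ q)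
    (k : L) (hk0 : k ≠ 0) (hk : star k = k) :
    #(univ.filter fun x : L => x * star x = k) = q + 1 := by
  have hq : 2 ≤ q := by
    have h1 : 1 < Fintype.card L := Fintype.one_lt_card
    rw [hL] at h1
    by_contra h
    push Not at h
    interval_cases q <;> simp at h1
  have hN0 : ∀ x : L, x * star x = 0 ↔ x = 0 := fun x => by
    rw [mul_eq_zero, star_eq_zero, or_self]
  have hNfix : ∀ x : L, star (x * star x) = x * star x := fun x => by
    rw [star_mul', star_star, mul_comm]
  -- the fibres over the non-zero fixed points, restricted to the non-zero elements
  have hfib : ∀ c ∈ (univ.filter fun k : L => k ≠ 0 ∧ star k = k),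
      #{x ∈ univ.filter (fun x : L => x ≠ 0) | x * star x = c} = q + 1 := by
    apply card_fibre_eq_of_le
    · intro x hx
      rw [mem_filter] at hx ⊢
      exact ⟨mem_univ _, fun h => hx.2 ((hN0 x).1 h), hNfix x⟩
    · exact fun c _ => card_fibre_norm_le hstar _ c
    · have hA : #(univ.filter fun x : L => x ≠ 0) = q ^ 2 - 1 := by
        rw [filter_ne', card_erase_of_mem (mem_univ _), card_univ, hL]
      rw [hA]
      calc #(univ.filter fun k : L => k ≠ 0 ∧ star k = k) * (q + 1) ≤ (q - 1) * (q + 1) :=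
            Nat.mul_le_mul_right _ (card_fixed_ne_zero_le hstar hq)
        _ = q ^ 2 - 1 := by
            have : q * (q + 1) = q ^ 2 + q := by ring
            rw [Nat.sub_mul, one_mul]
            omega
  rw [← hfib k (mem_filter.2 ⟨mem_univ _, hk0, hk⟩)]
  congr 1
  ext x
  simp only [mem_filter, mem_univ, true_and]
  exact ⟨fun h => ⟨fun hx => hk0 (by rw [← h, hx, zero_mul]), h⟩, fun h => h.2⟩

/-- **Cohn–Umans 2003, Prop. 11 (arXiv), the count `|SU₂(𝔽_q)| = q³ − q`**: over a field `L` with `q²`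
elements and `x̄ = x^q`, the equation `a ā + b b̄ = 1` has exactly `q³ − q` solutions — "For a fixed `b` with
`b b̄ ≠ 1`, there are `q + 1` corresponding choices of `a` that work; if `b b̄ = 1`, then `a = 0`. … Thus, there
are `(q² − q − 1)(q + 1) + (q + 1) = q³ − q` elements of `H₃`." (We sum over the first coordinate; the equation
is symmetric in `a, b`.) [cite: CohnUmans2003, Prop. 11 (arXiv, p. 8 L1–7; proof)] -/
theorem card_normPairs_eq (hL : Fintype.card L = q ^ 2) (hstar : ∀ x : L, star x = x ^ q) :
    Fintype.card {p : L × L // p.1 * star p.1 + p.2 * star p.2 = 1} = q ^ 3 - q := by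
  have hN0 : ∀ x : L, x * star x = 0 ↔ x = 0 := fun x => by
    rw [mul_eq_zero, star_eq_zero, or_self]
  have hNfix : ∀ x : L, star (x * star x) = x * star x := fun x => by
    rw [star_mul', star_star, mul_comm]
  -- the fibre over `0` is `{0}` ("if `b b̄ = 1`, then `a = 0`")
  have hfib0 : #(univ.filter fun x : L => x * star x = 0) = 1 := by
    rw [card_eq_one]
    refine ⟨0, ?_⟩
    ext x
    simp [hN0]
  -- sum over the first coordinate
  have hS : Fintype.card {p : L × L // p.1 * star p.1 + p.2 * star p.2 = 1} =
      ∑ a : L, #(univ.filter fun b : L => b * star b = 1 - a * star a) := by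
    refine (Fintype.card_congr
      (Equiv.subtypeProdEquivSigmaSubtype fun a b : L => a * star a + b * star b = 1)).trans ?_
    rw [Fintype.card_sigma]
    refine sum_congr rfl fun a _ => ?_
    rw [Fintype.card_subtype]
    congr 1
    ext b
    simp only [mem_filter, mem_univ, true_and]
    rw [eq_sub_iff_add_eq']
  rw [hS]
  have hterm : ∀ a : L, #(univ.filter fun b : L => b * star b = 1 - a * star a) =
      if a * star a = 1 then 1 else q + 1 := by
    intro a
    split_ifs with h
    · rw [h, sub_self]
      exact hfib0
    · exact card_fibre_norm_eq hL hstar _ (sub_ne_zero.2 (Ne.symm h)) (by rw [star_sub, star_one, hNfix])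
  simp_rw [hterm]
  rw [sum_ite, sum_const, sum_const, smul_eq_mul, smul_eq_mul, mul_one]
  -- "`q + 1` with `b b̄ = 1`"
  have h1 : #(univ.filter fun a : L => a * star a = 1) = q + 1 :=
    card_fibre_norm_eq hL hstar 1 one_ne_zero (star_one L)
  have h2 : #(univ.filter fun a : L => a * star a = 1) + #(univ.filter fun a : L => ¬a * star a = 1) =
      q ^ 2 := by
    rw [card_filter_add_card_filter_not, card_univ, hL]
  rw [h1] at h2 ⊢
  generalize #(univ.filter fun a : L => ¬a * star a = 1) = c at h2 ⊢
  -- `(q + 1) + (q² − q − 1)(q + 1) = q³ − q`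
  have h3 : q ^ 3 = q + 1 + c * (q + 1) + q := by
    have e1 : q ^ 3 = q * (q + 1 + c) := by rw [h2]; ring
    have e2 : q * (q + 1 + c) = q ^ 2 + q + q * c := by ring
    rw [e1, e2, ← h2]; ring
  omega

end Count

/-! ## An abstract star on `𝔽_{q²}` is the `q`-Frobenius -/

section Frobenius

variable (L : Type*) [Field L] [Fintype L] [StarRing L] {q : ℕ}

/-- "Let `x ↦ x̄` denote the Frobenius automorphism of `𝔽_{q²}` over `𝔽_q`": on a field with `q²` elements the
ONLY non-identity star (involutive ring automorphism) is `x ↦ x^q`. Proof: over the fixed field `K` of the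
star, the star is a `K`-algebra endomorphism, hence a power `Frob_{|K|}^j` of the Frobenius with `0 < j < [L:K]`
(Mathlib `FiniteField.bijective_frobeniusAlgHom_pow`); being an involution, `[L:K] ∣ 2j`, so `2j = [L:K]` and
`x̄ = x^{|K|^j}` with `(|K|^j)² = |K|^{[L:K]} = |L| = q²`. [cite: CohnUmans2003, Prop. 11 (arXiv, p. 7
L167–168; proof)] -/
theorem star_eq_pow_of_card_eq_sq (hL : Fintype.card L = q ^ 2) (h : ∃ x : L, star x ≠ x) (x : L) :
    star x = x ^ q := by
  classical
  let K : Subfield L := (starRingEnd L).eqLocusField (RingHom.id L)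
  haveI : Fintype K := Fintype.ofFinite K
  let σ : L →ₐ[K] L := ⟨starRingEnd L, fun k => k.2⟩
  have hσ : ∀ y : L, σ y = star y := fun y => rfl
  obtain ⟨⟨j, hj⟩, hjσ⟩ := (FiniteField.bijective_frobeniusAlgHom_pow K L).2 σ
  dsimp only at hjσ
  have hpow : ∀ y : L, star y = y ^ (Fintype.card K ^ j) := fun y => by
    have := DFunLike.congr_fun hjσ y
    rw [AlgHom.coe_pow, FiniteField.coe_frobeniusAlgHom, pow_iterate] at this
    rw [← hσ, ← this]
  have hj0 : j ≠ 0 := by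
    rintro rfl
    obtain ⟨x₀, hx₀⟩ := h
    exact hx₀ (by rw [hpow x₀, pow_zero, pow_one])
  have h2 : FiniteField.frobeniusAlgHom K L ^ (2 * j) = 1 := by
    rw [mul_comm, pow_mul, hjσ]
    ext y
    rw [pow_two, AlgHom.mul_apply, hσ, hσ, star_star, AlgHom.one_apply]
  have hdvd : Module.finrank K L ∣ 2 * j := by
    rw [← FiniteField.orderOf_frobeniusAlgHom K L]
    exact orderOf_dvd_of_pow_eq_one h2
  have h2j : 2 * j = Module.finrank K L := by
    obtain ⟨m, hm⟩ := hdvd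
    have hm2 : m < 2 := by
      by_contra hcon
      push Not at hcon
      have : Module.finrank K L * 2 ≤ Module.finrank K L * m := Nat.mul_le_mul_left _ hcon
      omega
    interval_cases m
    · omega
    · rw [hm, mul_one]
  have hcard : Fintype.card L = Fintype.card K ^ Module.finrank K L := Module.card_eq_pow_finrank
  have hq : q = Fintype.card K ^ j := by
    apply Nat.pow_left_injective two_ne_zero
    change q ^ 2 = (Fintype.card K ^ j) ^ 2
    rw [← hL, hcard, ← h2j, mul_comm, pow_mul]
  rw [hq]
  exact hpow x

end Frobenius

/-! ## Prop. 11 with the printed sizes -/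

section Sizes

variable (L : Type*) [Field L] [Fintype L] [StarRing L] {q : ℕ}

/-- **Cohn–Umans 2003, Prop. 11 (arXiv): `|H₃| = |SU₂(𝔽_q)| = q³ − q`** for `L = 𝔽_{q²}` with `x̄ = x^q`.
[cite: CohnUmans2003, Prop. 11 (arXiv, p. 8 L1–7)] -/
theorem CohnUmans2003_prop11_natCard_su2 (hL : Fintype.card L = q ^ 2) (hstar : ∀ x : L, star x = x ^ q) :
    Nat.card (su2 L) = q ^ 3 - q := by
  classical
  rw [natCard_su2, Nat.card_eq_fintype_card, card_normPairs_eq hL hstar]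

/-- **Cohn–Umans 2003, Prop. 11 (arXiv) / Prop. 5.2 (FOCS) with the printed sizes**: for `L = 𝔽_{q²}` with
`x̄ = x^q`, `SL₂(L)` realizes `⟨q², q², q³ − q⟩` (through `H₁ = U`, `H₂ = L`, `H₃ = SU₂`, by
`CohnUmans2003_prop11`). [cite: CohnUmans2003, Prop. 11 (arXiv, pp. 7–8)] -/
theorem CohnUmans2003_prop11_sizes (hL : Fintype.card L = q ^ 2) (hstar : ∀ x : L, star x = x ^ q) :
    RealizesTPP (SpecialLinearGroup (Fin 2) L) (q ^ 2) (q ^ 2) (q ^ 3 - q) := by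
  classical
  have h := CohnUmans2003_prop11 L
  rwa [hL, CohnUmans2003_prop11_natCard_su2 L hL hstar] at h

/-- The same for ANY non-identity star on a field with `q²` elements (it is the `q`-Frobenius,
`star_eq_pow_of_card_eq_sq`). [cite: CohnUmans2003, Prop. 11 (arXiv, pp. 7–8)] -/
theorem CohnUmans2003_prop11_sizes_of_ne (hL : Fintype.card L = q ^ 2) (h : ∃ x : L, star x ≠ x) :
    Nat.card (su2 L) = q ^ 3 - q ∧ RealizesTPP (SpecialLinearGroup (Fin 2) L) (q ^ 2) (q ^ 2) (q ^ 3 - q) :=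
  ⟨CohnUmans2003_prop11_natCard_su2 L hL (star_eq_pow_of_card_eq_sq L hL h),
    CohnUmans2003_prop11_sizes L hL (star_eq_pow_of_card_eq_sq L hL h)⟩

end Sizes

/-- **Cohn–Umans 2003, Prop. 11 (arXiv) / Prop. 5.2 (FOCS), literal form: "The group `SL₂(𝔽_{q²})` … realizes
`⟨q², q², q³ − q⟩`."** For every finite field `L` with `q²` elements, `SL₂(L)` realizes `⟨q², q², q³ − q⟩` (the
star `x ↦ x̄ = x^q`, "the Frobenius automorphism of `𝔽_{q²}` over `𝔽_q`", is the `q`-th power map — a ring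
homomorphism since `q` is a power of the characteristic, an involution since `x^{q²} = x` — and then
`CohnUmans2003_prop11_sizes` applies). [cite: CohnUmans2003, Prop. 11 (arXiv, pp. 7–8)] -/
theorem CohnUmans2003_prop11_literal (L : Type*) [Field L] [Fintype L] {q : ℕ} (hL : Fintype.card L = q ^ 2) :
    RealizesTPP (SpecialLinearGroup (Fin 2) L) (q ^ 2) (q ^ 2) (q ^ 3 - q) := by
  classical
  obtain ⟨p, hchar, n, hp, hcard⟩ := FiniteField.card' L
  haveI := hchar
  haveI : ExpChar L p := ExpChar.prime hp
  obtain ⟨m, -, hm⟩ : ∃ m ≤ (n : ℕ), q = p ^ m :=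
    (Nat.dvd_prime_pow hp).1 (by rw [← hcard, hL, sq]; exact dvd_mul_right q q)
  let σ : L →+* L := iterateFrobenius L p m
  have hσ : ∀ x, σ x = x ^ q := fun x => by rw [hm]; exact iterateFrobenius_def ..
  have hσσ : Function.Involutive σ := fun x => by
    rw [hσ, hσ, ← pow_mul, ← sq, ← hL, FiniteField.pow_card]
  letI : StarRing L :=
    { star := σ
      star_involutive := hσσ
      star_mul := fun x y => by rw [map_mul, mul_comm]
      star_add := map_add σ }
  exact CohnUmans2003_prop11_sizes L hL hσ

end Literature.Computability.AlgebraicComplexity
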